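import Summits.CriticalPhenomena.PercolationContinuityZ3.Theorems.Transplant.SkelPhiFaceNumsYRun
import HarnessLib

/-!
# N2 (frames-only node `SamePDropOfSkeletonFrm₁`, OPEN) — (F) column, y′-face: THE TWO-REGIME SEED CLEARANCE OF THE ALONG y′-RUN FROM TWO
# v-FREE, SIGN-FREE FLOORS (ruling (R-49)(b), design owner p3-g18 2026-08-23T14:51:34Z; value lemma by p1-g18, G-clr lineage of
# `SkelPhiFaceClearFloorsY` p1-g13)

N1's served field `hclrLo` clears the contact's zone column `|x′| ≤ M_u` BY ABSCISSA for every region `k ≤ Nr` of the along y′-run and therefore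
needs `0 ≤ v_L` (`Skelφ.hclrP_of_clearF`); the one-sided N2 server hops on `σ_h := 1` only, so at `v_L < 0` that field is unfeedable.  CURE OF RECORD
(R-49): per region, the ABSCISSA floor OR the LEVEL floor — abscissa for `k ≤ 3`, level for `k ≥ 4`.  This file is the pure-ℤ discharge:
* `Skelφ.yBoxLoT_ge_of_le_three` — `−4n − (k+1)·R′ ≤ yBoxLoT n v R′ k` for `k ≤ 3`, ANY `|v| ≤ n` (worst cases `k = 3` at `v = −n`, `k = 0` at `v = +n`);
* **`Skelφ.hclrT_of_floor4`** — the abscissa branch: `M + 4n + 4R′ < a ⟹ ∀ k ≤ 3, M < yBoxLoT n v R′ k + a` (`a := σ·yL 0`, `M := M_u`, `R′ := R′0`);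
* `Skelφ.sub_add_one_ediv`, `Skelφ.three_mul_ediv_le` (`⌊(A−U+1)/U⌋ = ⌊(A+1)/U⌋ − 1`, `⌊3A/U⌋ ≤ 3⌊A/U⌋ + 2`);
* **`Skelφ.hclrS_of_floor`** — the level branch: `0 ≤ M`, `M + q + 5R′ + 8 ≤ ⌊nℓ/U⌋ ⟹ ∀ k ≥ 4, M < yBoxLoS n ℓ h q R′ k`
  (`sLo = ⌊(nℓ+1)/U⌋ − 1 ≥ ⌊nℓ/U⌋ − 1 ≥ R′`, `La = ⌊3nℓ/U⌋ + 1 ≤ 3⌊nℓ/U⌋ + 3`, `k·(sLo − R′) ≥ 4·(sLo − R′)`);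
* `Skelφ.yBoxLoS_ge_of_four_le`, **`Skelφ.hclrS_of_floor_off`**, **`Skelφ.hclr2_of_floors_off`** — the same with a signed ORIGIN OFFSET `b` in the level branch
  (`MS < yBoxLoS k + b` from `R′ + 1 ≤ ⌊nℓ/U⌋`, `MS − b + q + 5R′ + 8 ≤ ⌊nℓ/U⌋`; hp-8 g43's `FloorsY2W.hclrLo` shape, appended 2026-08-23).
* `Skelφ.yBoxLoS_ge_all`, **`Skelφ.hclrS_all_of_origin`**, `Skelφ.hclr2_of_origin` — LEVEL-FIRST ((c3)): from an origin level `b ≥ M + q + R′ + La + 1` the level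
  branch covers EVERY `k` (appended 2026-08-23).
* **`Skelφ.hclr2_of_floors`** — the field-shaped join `∀ k ≤ Nr, (MT < yBoxLoT n v R′ k + a) ∨ (MS < yBoxLoS n ℓ h q R′ k)` (any `Nr`; `MT`, `MS` kept apart:
  the zone's column half-width resp. its level extent).
So the recession term `(Nr+1)·R′` of `KS.clearF_s/d/t` disappears (large `k` is the level branch) and no hypothesis on the sign of `v` remains.
builds on p205010 (kernel theorem, internal audit signed; external expert review pending) — nothing in this file uses p205010; NOTHING is claimed about the
open node `SamePDropOfSkeletonFrm₁`; pure integer arithmetic, no landed file edited.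
Lane `prim-bschramm`, seat `prim-bschramm-p1` (gen 18); helper file (`--supports stmt-CriticalPhenomena-4575 --as helper`).
[cite: KozmaNitzan2024, §4 Lemma 11 (pp. 22–23)] [cite: MartineauTassion2017, §4.3 Lemma 4.2]
-/

namespace Summit.CriticalPhenomena.PercolationContinuityZ3.Theorems.Transplant

namespace Skelφ

/-! ## The abscissa branch (`k ≤ 3`) -/

/-- **The transverse floor of the first four regions is v-free and sign-free**: `−4n − (k+1)·R′ ≤ yBoxLoT n v R′ k` for `k ≤ 3`, `|v| ≤ n`
(`yBoxLoT k = (k−1)·v − 2n − (k+1)·R′`; `(k−1)·v ≥ −2n` for `k ≤ 3`). [folklore] -/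
theorem yBoxLoT_ge_of_le_three {n : ℕ} {v : ℤ} (hv : |v| ≤ n) (R' : ℕ) {k : ℕ} (hk : k ≤ 3) :
    -(4 * (n : ℤ)) - ((k : ℤ) + 1) * R' ≤ yBoxLoT n v R' k := by
  rw [abs_le] at hv
  have h1 : ((((n : ℤ) + v).toNat : ℕ) : ℤ) = n + v := Int.toNat_of_nonneg (by linarith)
  unfold yBoxLoT
  rw [h1]
  have hk' : (k : ℤ) ≤ 3 := by exact_mod_cast hk
  rcases Nat.eq_zero_or_pos k with rfl | hk1
  · push_cast; linarith
  · have hk1' : (1 : ℤ) ≤ k := by exact_mod_cast hk1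
    nlinarith [mul_le_mul_of_nonneg_left hv.1 (by linarith : (0 : ℤ) ≤ (k : ℤ) - 1)]

/-- **`hclrLo`, ABSCISSA BRANCH, from the v-free sign-free origin floor** ((R-49)(b)): `M + 4n + 4R′ < a` gives `M < yBoxLoT n v R′ k + a` for every
`k ≤ 3` and every `|v| ≤ n` (at the node: `a := σ·yL 0`, `M := M_u`, `R′ := R′0`). [cite: KozmaNitzan2024, §4 Lemma 11 (p. 22)] -/
theorem hclrT_of_floor4 {n : ℕ} {v : ℤ} (hv : |v| ≤ n) (R' : ℕ) {a M : ℤ} (hF : M + 4 * n + 4 * R' < a) :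
    ∀ k ≤ 3, M < yBoxLoT n v R' k + a := by
  intro k hk
  have h := yBoxLoT_ge_of_le_three hv R' hk
  have hk' : (k : ℤ) ≤ 3 := by exact_mod_cast hk
  have hR : (0 : ℤ) ≤ R' := Nat.cast_nonneg _
  nlinarith

/-! ## The level branch (`k ≥ 4`) -/

/-- `⌊(A − U + 1)/U⌋ = ⌊(A + 1)/U⌋ − 1` (`U ≠ 0`). [folklore] -/
theorem sub_add_one_ediv (A : ℤ) {U : ℤ} (hU : U ≠ 0) : (A - U + 1) / U = (A + 1) / U - 1 := by
  rw [show A - U + 1 = A + 1 + (-1) * U by ring, Int.add_mul_ediv_right _ _ hU]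
  ring

/-- `⌊3A/U⌋ ≤ 3·⌊A/U⌋ + 2` (`0 < U`). [folklore] -/
theorem three_mul_ediv_le (A : ℤ) {U : ℤ} (hU : 0 < U) : 3 * A / U ≤ 3 * (A / U) + 2 := by
  have h1 := Int.mul_ediv_add_emod A U
  have h2 := Int.emod_nonneg A hU.ne'
  have h3 := Int.emod_lt_of_pos A hU
  rw [show 3 * A = 3 * (A % U) + 3 * (A / U) * U by linarith, Int.add_mul_ediv_right _ _ hU.ne']
  have h4 : 3 * (A % U) / U < 3 := by
    rw [Int.ediv_lt_iff_lt_mul hU]; linarith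
  linarith

/-- **`hclrLo`, LEVEL BRANCH, from one level floor** ((R-49)(b)): `0 ≤ M`, `M + q + 5R′ + 8 ≤ ⌊nℓ/U⌋` (`U := shearUnit n h`) give
`M < yBoxLoS n ℓ h q R′ k` for every `k ≥ 4` (`yBoxLoS k = k·sLo − q − k·R′ − R′ − La`, `sLo ≥ ⌊nℓ/U⌋ − 1 ≥ R′`, `La ≤ 3⌊nℓ/U⌋ + 3`).
[cite: KozmaNitzan2024, §4 Lemma 11 (p. 22)] -/
theorem hclrS_of_floor {n : ℕ} (hn : 1 ≤ n) (h : ℤ) (ℓ q R' : ℕ) {M : ℤ} (hM : 0 ≤ M)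
    (hF : M + q + 5 * R' + 8 ≤ (n : ℤ) * ℓ / (shearUnit n h : ℕ)) : ∀ k, 4 ≤ k → M < yBoxLoS n ℓ h q R' k := by
  intro k hk
  have hU : (0 : ℤ) < ((shearUnit n h : ℕ) : ℤ) := by exact_mod_cast shearUnit_pos hn h
  have hLa : (((3 * (n * ℓ) / shearUnit n h + 1 : ℕ)) : ℤ) = 3 * ((n : ℤ) * ℓ) / ((shearUnit n h : ℕ) : ℤ) + 1 := by push_cast; ring_nf
  unfold yBoxLoS
  rw [hLa, sub_add_one_ediv _ hU.ne']
  set U : ℤ := ((shearUnit n h : ℕ) : ℤ)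
  set A : ℤ := (n : ℤ) * ℓ
  have hmono : A / U ≤ (A + 1) / U := Int.ediv_le_ediv hU (by linarith)
  have h3 := three_mul_ediv_le A hU
  have hq : (0 : ℤ) ≤ q := Nat.cast_nonneg _
  have hR : (0 : ℤ) ≤ R' := Nat.cast_nonneg _
  have hk' : (4 : ℤ) ≤ k := by exact_mod_cast hk
  have hpos : 0 ≤ (A + 1) / U - 1 - R' := by linarith
  nlinarith [mul_le_mul_of_nonneg_right hk' hpos]

/-! ## The field-shaped join -/

/-- **THE TWO-REGIME CLEARANCE** ((R-49)(a)'s field shape): from the abscissa floor `MT + 4n + 4R′ < a` and the level floor `MS + q + 5R′ + 8 ≤ ⌊nℓ/U⌋`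
(`0 ≤ MS`), every region `k ≤ Nr` of the along y′-run clears the zone by abscissa (`k ≤ 3`) or by level (`k ≥ 4`) — no hypothesis on the sign of `v`,
no recession term in `Nr`. [cite: KozmaNitzan2024, §4 Lemma 11 (pp. 22–23)] -/
theorem hclr2_of_floors {n : ℕ} (hn : 1 ≤ n) {v : ℤ} (hv : |v| ≤ n) (h : ℤ) (ℓ q R' Nr : ℕ) {a MT MS : ℤ}
    (hT : MT + 4 * n + 4 * R' < a) (hMS : 0 ≤ MS) (hS : MS + q + 5 * R' + 8 ≤ (n : ℤ) * ℓ / (shearUnit n h : ℕ)) :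
    ∀ k ≤ Nr, MT < yBoxLoT n v R' k + a ∨ MS < yBoxLoS n ℓ h q R' k := by
  intro k _
  rcases Nat.lt_or_ge k 4 with hk | hk
  · exact Or.inl (hclrT_of_floor4 hv R' hT k (by omega))
  · exact Or.inr (hclrS_of_floor hn h ℓ q R' hMS hS k hk)

/-! ## The level branch with an origin offset (hp-8 g43 2026-08-23T15:16:58Z: `FloorsY2W.hclrLo` compares region levels `lev(yL) + [yBoxLoS k, yBoxHiS k]`
with the seed box `|lev| ≤ U·M_z`; the offset `b := lev(yL)` is signed) -/

/-- **The level floor of every region `k ≥ 4` in closed-bound form**: `⌊nℓ/U⌋ − q − 5R′ − 7 ≤ yBoxLoS n ℓ h q R′ k` as soon as `R′ + 1 ≤ ⌊nℓ/U⌋`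
(`sLo = ⌊(nℓ+1)/U⌋ − 1 ≥ R′`, `La ≤ 3⌊nℓ/U⌋ + 3`, `k·(sLo − R′) ≥ 4·(sLo − R′)`). [folklore] -/
theorem yBoxLoS_ge_of_four_le {n : ℕ} (hn : 1 ≤ n) (h : ℤ) (ℓ q R' : ℕ) (hR : (R' : ℤ) + 1 ≤ (n : ℤ) * ℓ / (shearUnit n h : ℕ)) :
    ∀ k, 4 ≤ k → (n : ℤ) * ℓ / (shearUnit n h : ℕ) - q - 5 * R' - 7 ≤ yBoxLoS n ℓ h q R' k := by
  intro k hk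
  have hU : (0 : ℤ) < ((shearUnit n h : ℕ) : ℤ) := by exact_mod_cast shearUnit_pos hn h
  have hLa : (((3 * (n * ℓ) / shearUnit n h + 1 : ℕ)) : ℤ) = 3 * ((n : ℤ) * ℓ) / ((shearUnit n h : ℕ) : ℤ) + 1 := by push_cast; ring_nf
  unfold yBoxLoS
  rw [hLa, sub_add_one_ediv _ hU.ne']
  set U : ℤ := ((shearUnit n h : ℕ) : ℤ)
  set A : ℤ := (n : ℤ) * ℓ
  have hmono : A / U ≤ (A + 1) / U := Int.ediv_le_ediv hU (by linarith)
  have h3 := three_mul_ediv_le A hU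
  have hq : (0 : ℤ) ≤ q := Nat.cast_nonneg _
  have hk' : (4 : ℤ) ≤ k := by exact_mod_cast hk
  have hpos : 0 ≤ (A + 1) / U - 1 - R' := by linarith
  nlinarith [mul_le_mul_of_nonneg_right hk' hpos]

/-- **`hclrLo`, LEVEL BRANCH WITH ORIGIN OFFSET** ((R-49)(b), hp-8 g43's field shape): `R′ + 1 ≤ ⌊nℓ/U⌋` and `M − b + q + 5R′ + 8 ≤ ⌊nℓ/U⌋` give
`M < yBoxLoS n ℓ h q R′ k + b` for every `k ≥ 4` (`b` signed and free; at the node `M := U·M_z`, `b := lev(yL)`). [cite: KozmaNitzan2024, §4 Lemma 11 (p. 22)] -/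
theorem hclrS_of_floor_off {n : ℕ} (hn : 1 ≤ n) (h : ℤ) (ℓ q R' : ℕ) {M b : ℤ} (hR : (R' : ℤ) + 1 ≤ (n : ℤ) * ℓ / (shearUnit n h : ℕ))
    (hF : M - b + q + 5 * R' + 8 ≤ (n : ℤ) * ℓ / (shearUnit n h : ℕ)) : ∀ k, 4 ≤ k → M < yBoxLoS n ℓ h q R' k + b := by
  intro k hk
  have := yBoxLoS_ge_of_four_le hn h ℓ q R' hR k hk
  linarith

/-- **THE TWO-REGIME CLEARANCE WITH ORIGIN OFFSET** (hp-8 g43's `FloorsY2W.hclrLo` shape): from the abscissa floor `MT + 4n + 4R′ < a`, `R′ + 1 ≤ ⌊nℓ/U⌋`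
and the level floor `MS − b + q + 5R′ + 8 ≤ ⌊nℓ/U⌋`, every region `k ≤ Nr` clears the seed box by abscissa (`k ≤ 3`) or by level (`k ≥ 4`):
`MT < yBoxLoT n v R′ k + a ∨ MS < yBoxLoS n ℓ h q R′ k + b` — no hypothesis on the signs of `v`, `b`. [cite: KozmaNitzan2024, §4 Lemma 11 (pp. 22–23)] -/
theorem hclr2_of_floors_off {n : ℕ} (hn : 1 ≤ n) {v : ℤ} (hv : |v| ≤ n) (h : ℤ) (ℓ q R' Nr : ℕ) {a MT MS b : ℤ}
    (hT : MT + 4 * n + 4 * R' < a) (hR : (R' : ℤ) + 1 ≤ (n : ℤ) * ℓ / (shearUnit n h : ℕ))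
    (hS : MS - b + q + 5 * R' + 8 ≤ (n : ℤ) * ℓ / (shearUnit n h : ℕ)) :
    ∀ k ≤ Nr, MT < yBoxLoT n v R' k + a ∨ MS < yBoxLoS n ℓ h q R' k + b := by
  intro k _
  rcases Nat.lt_or_ge k 4 with hk | hk
  · exact Or.inl (hclrT_of_floor4 hv R' hT k (by omega))
  · exact Or.inr (hclrS_of_floor_off hn h ℓ q R' hR hS k hk)

/-! ## LEVEL-FIRST: every region from an origin above the seed prism's along shadow ((c3), hp-8 g43 2026-08-23T15:29:45Z / lead g13 15:32:03Z:
if the run's origin level `b` satisfies `M + q + R′ + La + 1 ≤ b`, the level branch covers EVERY `k ≥ 0` — no abscissa floor, no east offset, no sign of `v`) -/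

/-- **The level floor of EVERY region in closed-bound form**: `−q − R′ − La ≤ yBoxLoS n ℓ h q R′ k` for all `k` as soon as `R′ + 1 ≤ ⌊nℓ/U⌋`
(`La := ⌊3nℓ/U⌋ + 1` the along shadow, `sLo ≥ ⌊nℓ/U⌋ − 1 ≥ R′` so `k·(sLo − R′) ≥ 0`; `yBoxLoS 0 = −q − R′ − La` is the worst case). [folklore] -/
theorem yBoxLoS_ge_all {n : ℕ} (hn : 1 ≤ n) (h : ℤ) (ℓ q R' : ℕ) (hR : (R' : ℤ) + 1 ≤ (n : ℤ) * ℓ / (shearUnit n h : ℕ)) :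
    ∀ k, -(q : ℤ) - R' - ((3 * (n * ℓ) / shearUnit n h + 1 : ℕ) : ℤ) ≤ yBoxLoS n ℓ h q R' k := by
  intro k
  have hU : (0 : ℤ) < ((shearUnit n h : ℕ) : ℤ) := by exact_mod_cast shearUnit_pos hn h
  unfold yBoxLoS
  rw [sub_add_one_ediv _ hU.ne']
  set U : ℤ := ((shearUnit n h : ℕ) : ℤ)
  set A : ℤ := (n : ℤ) * ℓ
  have hmono : A / U ≤ (A + 1) / U := Int.ediv_le_ediv hU (by linarith)
  have hk0 : (0 : ℤ) ≤ k := Nat.cast_nonneg _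
  have hpos : 0 ≤ (A + 1) / U - 1 - R' := by linarith
  nlinarith [mul_nonneg hk0 hpos]

/-- **`hclrLo`, LEVEL-FIRST** ((c3)): from `R′ + 1 ≤ ⌊nℓ/U⌋` and an origin level `b` with `M + q + R′ + La + 1 ≤ b` (`La := ⌊3nℓ/U⌋ + 1`), EVERY region clears
the seed box by level: `∀ k, M < yBoxLoS n ℓ h q R′ k + b` (at the node `M := U·M_z`, `b := lev(yL)`; no abscissa floor, no hypothesis on `v`).
[cite: KozmaNitzan2024, §4 Lemma 11 (p. 22)] -/
theorem hclrS_all_of_origin {n : ℕ} (hn : 1 ≤ n) (h : ℤ) (ℓ q R' : ℕ) {M b : ℤ} (hR : (R' : ℤ) + 1 ≤ (n : ℤ) * ℓ / (shearUnit n h : ℕ))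
    (hb : M + q + R' + ((3 * (n * ℓ) / shearUnit n h + 1 : ℕ) : ℤ) + 1 ≤ b) : ∀ k, M < yBoxLoS n ℓ h q R' k + b := by
  intro k
  have := yBoxLoS_ge_all hn h ℓ q R' hR k
  linarith

/-- **LEVEL-FIRST in the field's shape**: under the origin row of `hclrS_all_of_origin` the two-regime field holds by its level disjunct for every
`k ≤ Nr` (any `a`, `MT`, `v`). [cite: KozmaNitzan2024, §4 Lemma 11 (pp. 22–23)] -/
theorem hclr2_of_origin {n : ℕ} (hn : 1 ≤ n) (v h : ℤ) (ℓ q R' Nr : ℕ) {a MT MS b : ℤ} (hR : (R' : ℤ) + 1 ≤ (n : ℤ) * ℓ / (shearUnit n h : ℕ))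
    (hb : MS + q + R' + ((3 * (n * ℓ) / shearUnit n h + 1 : ℕ) : ℤ) + 1 ≤ b) :
    ∀ k ≤ Nr, MT < yBoxLoT n v R' k + a ∨ MS < yBoxLoS n ℓ h q R' k + b :=
  fun k _ => Or.inr (hclrS_all_of_origin hn h ℓ q R' hR hb k)

end Skelφ

end Summit.CriticalPhenomena.PercolationContinuityZ3.Theorems.Transplant
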